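import Summits.MatrixMultiplication.OmegaCensus.SmallFormats.MatMul22nAllOnesRowBlocks
import Summits.MatrixMultiplication.OmegaCensus.SmallFormats.MatMul22nF3LineLemmas
import HarnessLib

/-!
# ω-census family (a): the κ-LINE STRUCTURE of an all-ones row over `𝔽₃` — types `(2,2)`/`(2,1,1)` only, and the rank-one shapes

Cell `pub-omega` (unit `pub-omega-tensor`, gen 40), topic `Summits/MatrixMultiplication/OmegaCensus` (sub-folder
`SmallFormats`). Framing (verbatim): lottery ticket; floor = certified bounds/negative ranges. HONEST FRAMING: M1-LEAN-BLUEPRINT F1 glue (memo DEFLATION-g40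
§2): a row cheap plane `span(c)` whose four terms `t j` sit in four column planes `C j` (direction `μ_j =` the `j`-th point of `P¹(𝔽₃)`, cheap data `b j`), each
`t j` outside the other three column planes, with linearly independent Y-forms. Conclusion (`AllOnesRowTypes.row_structure`): a line map `L : Fin 4 → Fin 4` (column
↦ the left-null line of its Gram block, as one of the four points) which is NOT injective and has no triple coincidence — i.e. κ-type `(2,2)` or `(2,1,1)` — together
with: the blocks are non-zero, `rep (L j)` spans the left null line of block `j`, and for any coincident pair `L a = L b` every term at a column outside the pair has
BOTH Y-form rows proportional to the kill vector `∑_l rep(L a)_l • c l`. Literal tables, no definitions. Nothing here is a bound on `ω`.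
-/

namespace Summit.MatrixMultiplication.OmegaCensus.SmallFormats

open Finset Module Matrix
open Literature.Computability.AlgebraicComplexity

namespace AllOnesRowTypes

variable {n : ℕ} {ι : Type*} [Fintype ι]

/-- **The κ-line structure of an all-ones row over `𝔽₃`.** -/
theorem row_structure [DecidableEq ι] (β : BilinComp (mulBilin (ZMod 3) 2 2 n) ι) (R : Finset ι) (c : Fin 2 → (Fin n → ZMod 3))
    (hcr : ∀ s, s ∈ R → ∀ κ : Fin 2, ∃ a : Fin 2 → ZMod 3, (fun j => β.g s (Matrix.single κ j (1 : ZMod 3))) = ∑ m, a m • c m)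
    (C : Fin 4 → Finset ι) (hC4 : ∀ j, (C j).card = 4) (b : Fin 4 → Fin 2 → (Fin n → ZMod 3))
    (hbi : ∀ j (a : Fin 2 → ZMod 3), ∑ m, a m • b j m = 0 → ∀ m, a m = 0)
    (hbch : ∀ j t, t ∉ C j → ∀ m, β.g t (Matrix.vecMulVec (![-((![![1, 0], ![0, 1], ![1, 1], ![1, 2]] : Fin 4 → Fin 2 → ZMod 3) j 1), (![![1, 0], ![0, 1], ![1, 1], ![1, 2]] : Fin 4 → Fin 2 → ZMod 3) j 0] : Fin 2 → ZMod 3) (b j m)) = 0)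
    (t : Fin 4 → ι) (htR : ∀ j, t j ∈ R) (htC : ∀ j, t j ∈ C j) (htC' : ∀ j j', j ≠ j' → t j ∉ C j')
    (hind : LinearIndependent (ZMod 3) (fun j => β.g (t j))) :
    ∃ L : Fin 4 → Fin 4,
      (∀ j m, (∑ l, (![![1, 0], ![0, 1], ![1, 1], ![1, 2]] : Fin 4 → Fin 2 → ZMod 3) (L j) l • c l) ⬝ᵥ b j m = 0) ∧
      (∀ j (x : Fin 2 → ZMod 3), (∀ m, (∑ l, x l • c l) ⬝ᵥ b j m = 0) →
        x 0 * (![![1, 0], ![0, 1], ![1, 1], ![1, 2]] : Fin 4 → Fin 2 → ZMod 3) (L j) 1 - x 1 * (![![1, 0], ![0, 1], ![1, 1], ![1, 2]] : Fin 4 → Fin 2 → ZMod 3) (L j) 0 = 0) ∧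
      (∀ j, ∃ l m, c l ⬝ᵥ b j m ≠ 0) ∧
      ¬ Function.Injective L ∧
      (∀ a b' d, a ≠ b' → a ≠ d → b' ≠ d → ¬ (L a = L b' ∧ L a = L d)) ∧
      (∀ a b' j, a ≠ b' → L a = L b' → j ≠ a → j ≠ b' →
        ∃ η : Fin 2 → ZMod 3, ∀ q : Fin 2, (fun jj => β.g (t j) (Matrix.single q jj (1 : ZMod 3))) = η q • ∑ l, (![![1, 0], ![0, 1], ![1, 1], ![1, 2]] : Fin 4 → Fin 2 → ZMod 3) (L a) l • c l) := by
  classical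
  set rep : Fin 4 → Fin 2 → ZMod 3 := (![![1, 0], ![0, 1], ![1, 1], ![1, 2]] : Fin 4 → Fin 2 → ZMod 3) with hrep
  -- coefficient matrices of the four terms
  have hA : ∀ j, ∃ A : Matrix (Fin 2) (Fin 2) (ZMod 3), ∀ κ, (fun jj => β.g (t j) (Matrix.single κ jj (1 : ZMod 3))) = ∑ l, A κ l • c l := by
    intro j
    choose a ha using hcr (t j) (htR j)
    exact ⟨Matrix.of fun κ l => a κ l, fun κ => ha κ⟩
  choose A hA using hA
  -- Gram blocks and their basic identities
  have hP : ∀ j m (x : Fin 2 → ZMod 3), (∑ l, x l • c l) ⬝ᵥ b j m = Matrix.vecMul x (Matrix.of fun l m => c l ⬝ᵥ b j m) m :=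
    fun j m x => GramNondeg.combo_dotProduct_eq_vecMul c (b j) x m
  have hnu : ∀ j : Fin 4, (![-(rep j 1), rep j 0] : Fin 2 → ZMod 3) ≠ 0 := by rw [hrep]; decide
  have hrep_ne : ∀ r : Fin 4, rep r ≠ 0 := by rw [hrep]; decide
  have hg : ∀ j j' m, β.g (t j) (Matrix.vecMulVec ![-(rep j' 1), rep j' 0] (b j' m)) =
      Matrix.vecMul (Matrix.vecMul ![-(rep j' 1), rep j' 0] (A j)) (Matrix.of fun l m => c l ⬝ᵥ b j' m) m :=
    fun j j' m => GramNondeg.g_cheapInput_eq_vecMul β (t j) c (b j') _ (A j) (hA j) m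
  -- blocks non-zero
  have hPnz : ∀ j, (Matrix.of fun l m => c l ⬝ᵥ b j m : Matrix (Fin 2) (Fin 2) (ZMod 3)) ≠ 0 := by
    intro j hz
    obtain ⟨l, m, hlm⟩ := AllOnesRow.gram_ne_zero β _ (hnu j) (C j) (hC4 j) (b j) (hbi j) (hbch j) c (t j) (htC j) (hcr (t j) (htR j))
    exact hlm (by have := congrFun (congrFun hz l) m; simpa using this)
  -- blocks singular
  have hPdet : ∀ j, (Matrix.of fun l m => c l ⬝ᵥ b j m : Matrix (Fin 2) (Fin 2) (ZMod 3)).det = 0 := by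
    intro j
    refine AllOnesRow.gram_det_eq_zero β _ (hnu j) (C j) (b j) (hbch j) c (fun i => t (Fin.succAbove j i))
      (fun i => htC' _ _ (Fin.succAbove_ne j i)) (fun i κ => hcr _ (htR _) κ) ?_
    exact hind.comp _ Fin.succAbove_right_injective
  -- left null vectors, normalised to representatives
  have hLex : ∀ j, ∃ r : Fin 4, Matrix.vecMul (rep r) (Matrix.of fun l m => c l ⬝ᵥ b j m) = 0 := by
    intro j
    obtain ⟨v, hv, hvP⟩ := Matrix.exists_vecMul_eq_zero_iff.mpr (hPdet j)
    obtain ⟨r, hr⟩ := F3Lines.exists_rep v hv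
    refine ⟨r, ?_⟩
    rcases hr with hr | hr
    · rw [hrep, ← hr]; exact hvP
    · have : rep r = -v := by rw [hr, neg_neg]
      rw [this, Matrix.neg_vecMul, hvP, neg_zero]
  choose L hL using hLex
  -- null space maximality
  have hnull : ∀ j (x : Fin 2 → ZMod 3), Matrix.vecMul x (Matrix.of fun l m => c l ⬝ᵥ b j m) = 0 → x 0 * rep (L j) 1 - x 1 * rep (L j) 0 = 0 :=
    fun j x hx => F3Lines.leftNull_parallel _ (hPnz j) _ x (hrep_ne (L j)) (hL j) hx
  -- cheapness of `t j` for the other columns, and own-column visibility, in cross form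
  have hcheap : ∀ j j', j' ≠ j →
      (Matrix.vecMul ![-(rep j' 1), rep j' 0] (A j)) 0 * rep (L j') 1 - (Matrix.vecMul ![-(rep j' 1), rep j' 0] (A j)) 1 * rep (L j') 0 = 0 := by
    intro j j' hjj'
    refine hnull j' _ ?_
    funext m
    rw [← hg j j' m, Pi.zero_apply]
    exact hbch j' (t j) (htC' j j' (Ne.symm hjj')) m
  have hadm : ∀ j, (Matrix.vecMul ![-(rep j 1), rep j 0] (A j)) 0 * rep (L j) 1 - (Matrix.vecMul ![-(rep j 1), rep j 0] (A j)) 1 * rep (L j) 0 ≠ 0 := by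
    intro j h0
    obtain ⟨m, hm⟩ := ColumnSubcomp.sees_cheap_input β _ (hnu j) (C j) (hC4 j) (b j) (hbi j) (hbch j) (t j) (htC j)
    apply hm
    rw [hg j j m]
    -- the vector ν_j A_j is on the null line, hence in the null space
    have hx : Matrix.vecMul ![-(rep j 1), rep j 0] (A j) = 0 ∨ Matrix.vecMul ![-(rep j 1), rep j 0] (A j) = rep (L j) ∨
        Matrix.vecMul ![-(rep j 1), rep j 0] (A j) = -rep (L j) := by
      have := (F3Lines.cross_rep_eq_zero_iff (Matrix.vecMul ![-(rep j 1), rep j 0] (A j)) (L j)).mp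
      rw [hrep] at h0 ⊢; exact this h0
    rcases hx with hx | hx | hx
    · rw [hx, Matrix.zero_vecMul, Pi.zero_apply]
    · rw [hx, hL j, Pi.zero_apply]
    · rw [hx, Matrix.neg_vecMul, hL j, neg_zero, Pi.zero_apply]
  refine ⟨L, fun j m => ?_, fun j x hx => hnull j x ?_, fun j => ?_, ?_, ?_, ?_⟩
  · rw [hP]; exact congrFun (hL j) m
  · funext m; rw [← hP]; exact hx m
  · by_contra hno
    push Not at hno
    exact hPnz j (by ext l m; rw [Matrix.of_apply, Matrix.zero_apply]; exact hno l m)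
  · -- Lemma B
    intro hinj
    have := F3Lines.lemmaB L hinj 0 (A 0) (fun j' hj' => by have h := hcheap 0 j' hj'; rw [hrep] at h; exact h)
    apply hadm 0
    rw [hrep]; exact this
  · -- no triple coincidence
    intro a b' d hab had hbd ⟨h1, h2⟩
    apply hadm a
    have hb := hcheap a b' (Ne.symm hab)
    have hd := hcheap a d (Ne.symm had)
    rw [← h1] at hb; rw [← h2] at hd
    have := F3Lines.own_parallel_of_two_others a b' d (Ne.symm hab) (Ne.symm had) hbd (L a) (A a)
      (by rw [hrep] at hb; exact hb) (by rw [hrep] at hd; exact hd)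
    rw [hrep]; exact this
  · -- shapes
    intro a b' j hab hL' hja hjb
    have ha := hcheap j a hja.symm
    have hb := hcheap j b' hjb.symm
    rw [← hL'] at hb
    have hrows := F3Lines.shape_pair a b' hab (L a) (A j) (by rw [hrep] at ha; exact ha) (by rw [hrep] at hb; exact hb)
    -- each row of A j is 0, rep, or -rep
    have hq : ∀ q : Fin 2, ∃ e : ZMod 3, A j q = e • rep (L a) := by
      intro q
      have hcq : A j q 0 * rep (L a) 1 - A j q 1 * rep (L a) 0 = 0 := by
        fin_cases q
        · have := hrows.1; rw [hrep]; exact this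
        · have := hrows.2; rw [hrep]; exact this
      have hx := (F3Lines.cross_rep_eq_zero_iff (A j q) (L a)).mp (by rw [hrep] at hcq; exact hcq)
      rcases hx with hx | hx | hx
      · exact ⟨0, by rw [hx, zero_smul]⟩
      · exact ⟨1, by rw [one_smul, hrep]; exact hx⟩
      · exact ⟨-1, by rw [neg_one_smul, hrep]; exact hx⟩
    choose η hη using hq
    refine ⟨η, fun q => ?_⟩
    rw [hA j q, Finset.smul_sum]
    refine Finset.sum_congr rfl fun l _ => ?_
    have e : A j q l = η q * rep (L a) l := by rw [hη q, Pi.smul_apply, smul_eq_mul]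
    simp only [e, smul_smul]

end AllOnesRowTypes

end Summit.MatrixMultiplication.OmegaCensus.SmallFormats
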